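import Literature.MathematicalPhysics.QuantumFieldTheory.Balaban1983to89.B7Prop5GeneralLevels

/-!
# `Balaban1983to89.B7Prop5General` — T. Bałaban, *Averaging operations for lattice gauge theories*, Commun. Math. Phys. **98**
(1985) 17–51 [Balaban1985Averaging]: **PROPOSITION 5 AT A GENERAL REGULAR BACKGROUND `U₀`, k-UNIFORM, UNCONDITIONAL** — file
2/2: (147) «|Q_k(U₀; c, b)| ≦ 1 + 2C′₁α₀», (157) «|(δ/δA_b)C_k(U₀, A, c)| ≦ C₃|A|», (156) «|(δ/δA_b)Q_k(U₀, ηA, c)| ≦ 1 +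
2C′₁α₀ + C₃|A|» for B7's concrete composites `linCovIter`/`logCovIter`, every one-step binder of `B7Prop5GeneralLinear` /
`B7Prop5GeneralInduction` fed from `B7Prop5GeneralLevels` (file 1/2)

statement-level skeleton of published theorems with citation tags; proofs where landed; nothing here is a claim about the Yang–Mills mass gap

PDF held: `paper:balaban1985-cmp98-averaging` (journal page = PDF page + 16); pp. 39–42 [PDF 23–26] ((137)–(157), Prop. 5)
read from the materialised text layer `~/.lit/texts/paper-balaban1985-cmp98-averaging/p0023.txt`–`p0026.txt` and the renders.

CITATION HEADER / WHAT IS REPRODUCED.  SKELETON rows **B7.Prop5** («Prop. 5, (156)–(157)»; also (147) of row **B7.Eq139** and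
the inductions of row **B7.Eq149**, now with every input discharged) — cell `lit-balaban`, seat p06 gen 3 = unit
`lit-balaban-p06`; owner r04 (ACK 2026-08-21T04:30:51Z), referee ref-4.  p. 42, verbatim: *"Thus we have proved Proposition
5. The functional derivative of Q_k(U₀, ηA) is a bounded function for α₀, α₁ sufficiently small, and we have the bounds
|(δ/δA_b)Q_k(U₀, ηA, c)| ≦ 1 + 2C′₁α₀ + C₃|A| < 1 + 2C′₁α₀ + C₃α₁, (156) |(δ/δA_b)C_k(U₀, A, c)| ≦ C₃|A| < C₃α₁. (157)"*;
p. 41: *"This inequality is satisfied if C₃ > C″₁ and α₀, α₁ are sufficiently small"*; p. 40: *"|Q_k(U₀; c, b)| ≦ 1 +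
2C′₁α₀. (147)"*.  The proofs are `B7Prop5GeneralLinear.ineq147`/`linCovIter_bump_eq_zero` and
`B7Prop5GeneralInduction.prop5_157`/`prop5_156` (the printed inductions (143)–(147), (149)–(155), kernel since the NE7c
lineage) with their binders supplied by `B7Prop5GeneralLevels.{hadd,hsmul,h139,hloc,h148,hdiff}_levels` and (131) @gen
(`B7Eq123General.prop4_general`, p06 gen 2).

DICTIONARY (as in file 1 / `B7Prop5GeneralInduction`; `B = ηA`, `s_j = (Lʲ/Lᵏ)²`): `θ = thetaGen d L α₀` (print's `2C′₁α₀`),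
`C″₁ = C1ppGen d L`, `C₃ = C3Gen d L = 16C″₁`; (52) ↦ `pdev U₀ < α₀L^{−2k}`, `U₀` valued in an `AvgClosed` structure group `G`,
`C₀α₀ ≤ 1/3`, `4α₀ ≤ c₂′`; `|A| < α₁` ↦ `‖B_b‖ ≤ b` (`Lᵏb = |A|`); «α₀, α₁ sufficiently small» ↦ the displayed `hsmall`/`hc₃`
(Prop. 4's regime, `B7Eq123General.prop4_general`; `hc₃`: `4Lᵏb < c₃` so that every level argument sits inside (148)'s
radius `c₃/2`), `h145` («16dC′₁L^{−4}α₀ ≦ 1») and `h155` ((155) in the per-bond bookkeeping, `C″₁/C₃ = 1/16`) —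
`smallness_sufficient`: the last two FOLLOW from `2dθ ≤ L³/16` and `2dC₃Lᵏb ≤ 1`; the differential (137) in the single-bond
direction `X·δ_b` ↦ `HasLineDerivAt ℂ … (bump y μ X)` with the `η^d` of (138) rendered per bond (`B7Prop5Flat` DIVERGENCE (b)).

WHAT THIS FILE PROVES (kernel, 0 sorry, standard axioms; theorems only): **`prop5_general_147`** ((147) @gen per bond, `j ≤
k`, k-uniform: `‖LʲηQ_j(U₀)(Xδ_b)(c)‖ ≤ (1 + θs_j)·Lʲ·L^{−jd}·‖X‖`, zero unless `b ⊂ Bʲ(c₋) ∪ Bʲ(c₊)`),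
**`prop5_general_157`** ((157): `HasLineDerivAt` + `‖dC_j(B; Xδ_b)(c)‖ ≤ C₃(Lʲ)²L^{−jd}b‖X‖` + locality), **`prop5_general_156`**
((156): derivative of `Q_j(U₀, η·)(c)` = `dC_j + LʲηQ_j(U₀)(Xδ_b)`, norm `≤ ((1 + θs_j)Lʲ + C₃(Lʲ)²b)L^{−jd}‖X‖`),
`smallness_sufficient` (non-vacuity of `h145`/`h155`); §4 AT `j = k` IN THE PRINTED VARIABLES (`A` on the `η = L^{−k}`-lattice,
`|A| ≤ a`): **`prop5_general_157_printed`** (`|dC_k(U₀, A; Xδ_b)(c)| ≤ C₃|A|·η^d|X|` + locality) and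
**`prop5_general_156_printed`** (`|dQ_k(U₀, ηA; Xδ_b)(c)| ≤ (1 + θ + C₃|A|)·η^d|X|`, `θ` = print's `2C′₁α₀` — VERBATIM SHAPE of
(156)), the `U₀ ≠ 1` twins of `B7Prop5Flat.prop5_flat_157/156`.  `k` enters only through `s_j ≤ 1` and `Lʲb ≤ Lᵏb`.
DIVERGENCES from print: constants admissible, not optimal (print: `C₃ = 6C″₁`; here `16C″₁`); `ℤᵈ`, corner blocks,
`U1`/`AvgClosed` background; Prop. 7 (complex backgrounds) untouched (r04).  RELATION TO THE SUBSTRATE: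
`Summits/…/Support/ShellMeasureAverageProp5General` proves the same Summits-side (INTERFACES IF2-27: R5 pairing; nothing moved).
-/

noncomputable section

open scoped BigOperators
open NormedSpace Finset Metric

namespace Literature.MathematicalPhysics.QuantumFieldTheory.Balaban1983to89.B7Prop5General

open B7Prop1Explicit B7Prop1Local B7Prop2Explicit B7Prop3Flat B7Prop4Flat B7Eq92Concrete B7Prop3GeneralLinear
  B7Prop4GeneralLevels B7Ineq148 B7Prop5GeneralOperators B7Prop5GeneralLinear B7Prop5GeneralInduction B7Prop5GeneralLevels
open B7Prop5Flat (BondIn S1 bump smul_bump smul_line norm_real_smul)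
open B7Eq123General (prop4_general)

-- `Site` alone would resolve to the torus sites of `Setup.lean`; re-export the `ℤ^d` sites of `B7Prop1Explicit`.
export B7Prop1Explicit (Site)

variable {d : ℕ}

/-- `thetaGen ≥ 0` for `α₀ ≥ 0`. [folklore] -/
private theorem thetaGen_nonneg (d L : ℕ) {α₀ : ℝ} (hα : 0 ≤ α₀) : 0 ≤ thetaGen d L α₀ := by
  unfold thetaGen; positivity

/-- `C1ppGen > 0` (`L ≥ 1`). [folklore] -/
private theorem C1ppGen_pos (d : ℕ) {L : ℕ} (hL : 1 ≤ L) : 0 < C1ppGen d L := by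
  have : (0 : ℝ) < L := by exact_mod_cast hL
  unfold C1ppGen; positivity

/-- `C3Gen > 0` (`L ≥ 1`). [folklore] -/
private theorem C3Gen_pos (d : ℕ) {L : ℕ} (hL : 1 ≤ L) : 0 < C3Gen d L := by
  have := C1ppGen_pos d hL; unfold C3Gen; positivity

section Regime

variable {𝔸 : Type*} [NormedRing 𝔸] [NormedAlgebra ℂ 𝔸] [CompleteSpace 𝔸] [NormOneClass 𝔸]

variable (L : ℕ) (hL : 2 ≤ L) {G : Subgroup 𝔸ˣ} (hG : AvgClosed d L G) (k : ℕ)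
  (U₀ : Site d → Fin d → 𝔸ˣ) (hU₀ : ∀ x κ, U₀ x κ ∈ G) {α₀ : ℝ} (hα : 0 < α₀)
  (hα3 : C0 d * α₀ ≤ 1 / 3) (hα4 : 4 * α₀ ≤ c2' d L) (h52 : pdev U₀ < α₀ * (((L : ℝ) ^ k)⁻¹) ^ 2)

/-! ## §3 Proposition 5 at a general background, per bond, k-uniform (`B`-variables) -/

include hL hG hU₀ hα hα3 hα4 h52 in
/-- **(147) AT A GENERAL BACKGROUND, PER BOND, k-UNIFORM, UNCONDITIONAL** «|Q_k(U₀; c, b)| ≦ 1 + 2C′₁α₀»: for every `j ≤ k`,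
every unit-lattice bond `b = ⟨y, y + e_μ⟩`, `X ∈ 𝔸` and every bond `c = ⟨z, z + e_κ⟩` of the `j`-th lattice,
`‖LʲηQ_j(U₀)(Xδ_b)(c)‖ ≤ (1 + θ(Lʲ/Lᵏ)²)·Lʲ·L^{−jd}·‖X‖` (`θ = thetaGen d L α₀`; under «16dC′₁L^{−4}α₀ ≦ 1» = `h145`), and it
VANISHES unless `b ⊂ Bʲ(c₋) ∪ Bʲ(c₊)` — `B7Prop5GeneralLinear.ineq147` / `linCovIter_bump_eq_zero` with `h139` discharged by
`h139_levels`. [cite: Balaban1985Averaging, (146)–(147) p.40] -/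
theorem prop5_general_147 (h145 : 8 * d * thetaGen d L α₀ * (L : ℝ)⁻¹ ^ 4 ≤ 1) (y : Site d) (μ : Fin d) (X : 𝔸)
    {j : ℕ} (hj : j ≤ k) (z : Site d) (κ : Fin d) :
    ‖linCovIter L U₀ (bump y μ X) j z κ‖ ≤
        (1 + thetaGen d L α₀ * ((L : ℝ) ^ j * ((L : ℝ) ^ k)⁻¹) ^ 2) * ((L : ℝ) ^ j * (((L : ℝ) ^ j) ^ d)⁻¹) * ‖X‖ ∧
      (¬ BondIn (loK L j z) (bondHiK L j z κ) y μ → linCovIter L U₀ (bump y μ X) j z κ = 0) :=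
  ⟨ineq147 L hL U₀ k (thetaGen_nonneg d L hα.le) (h139_levels L hL hG k U₀ hU₀ hα hα3 hα4 h52) h145 y μ X hj z κ,
    linCovIter_bump_eq_zero L hL U₀ k (thetaGen_nonneg d L hα.le) (h139_levels L hL hG k U₀ hU₀ hα hα3 hα4 h52) h145
      y μ X hj z κ⟩

variable (B : Site d → Fin d → 𝔸) {b : ℝ} (hb : 0 ≤ b) (hB : ∀ x κ, ‖B x κ‖ ≤ b)
  (hsmall : Real.exp (4 * (800 * ((d : ℝ) + 1) ^ 2 * ((d : ℝ) + 4)) * α₀)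
    * (1 + 8 * (131072 * ((d : ℝ) + 1) ^ 2) * ((L : ℝ) ^ k * b)) ≤ 2)
  (hc₃ : 4 * ((L : ℝ) ^ k * b) < c3 d L)
  (h145 : 8 * d * thetaGen d L α₀ * (L : ℝ)⁻¹ ^ 4 ≤ 1)
  (h155 : (2 * (L : ℝ) - 1) * (L : ℝ)⁻¹ ^ 2 + 2 * d * thetaGen d L α₀ * (L : ℝ)⁻¹ ^ 3
    + 1 / 8 * (1 + 2 * d * thetaGen d L α₀ * (L : ℝ)⁻¹ ^ 2 + 2 * d * C3Gen d L * ((L : ℝ) ^ k * b)) * (L : ℝ)⁻¹ ^ 2 ≤ 1)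

include hL hG hU₀ hα hα3 hα4 h52 hb hB hsmall hc₃ in
/-- **(131) at every earlier level** «|Q_j(U₀, ηA)| ≦ 2Lʲηα₁» (`B7Eq123General.prop4_general`, p06 gen 2) and the radius
bookkeeping `2Lʲb < c₃/2` of (148)'s domain. [cite: Balaban1985Averaging, (131) p.38, p.37 (after (129))] -/
private theorem h131_levels :
    (∀ j < k, ∀ (x : Site d) (κ : Fin d), ‖logCovIter L U₀ B j x κ‖ ≤ 2 * ((L : ℝ) ^ j * b)) ∧
      ∀ j < k, 2 * ((L : ℝ) ^ j * b) < c3 d L / 2 := by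
  have hL1 : 1 ≤ L := le_trans (by norm_num) hL
  have hL1r : (1 : ℝ) ≤ L := by exact_mod_cast hL1
  have hLkb : 0 ≤ (L : ℝ) ^ k * b := by positivity
  have hc₃' : 2 * ((L : ℝ) ^ k * b) ≤ c3 d L := by linarith
  refine ⟨fun j hj => (prop4_general L hL hG k U₀ hU₀ hα hα3 hα4 h52 B hb hB hsmall hc₃' j hj.le).2, fun j hj => ?_⟩
  have hjk : (L : ℝ) ^ j * b ≤ (L : ℝ) ^ k * b := mul_le_mul_of_nonneg_right (pow_le_pow_right₀ hL1r hj.le) hb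
  linarith

omit [NormedRing 𝔸] [NormedAlgebra ℂ 𝔸] [CompleteSpace 𝔸] [NormOneClass 𝔸] in
include hL in
/-- `2C″₁/C₃ = 1/8` for `C₃ = 16C″₁`: the per-bond form of (155)'s quotient `C″₁/C₃`. [cite: Balaban1985Averaging, (155) p.41] -/
private theorem h155_of :
    (2 * (L : ℝ) - 1) * (L : ℝ)⁻¹ ^ 2 + 2 * d * thetaGen d L α₀ * (L : ℝ)⁻¹ ^ 3
        + 1 / 8 * (1 + 2 * d * thetaGen d L α₀ * (L : ℝ)⁻¹ ^ 2 + 2 * d * C3Gen d L * ((L : ℝ) ^ k * b)) * (L : ℝ)⁻¹ ^ 2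
          ≤ 1 →
      (2 * (L : ℝ) - 1) * (L : ℝ)⁻¹ ^ 2 + 2 * d * thetaGen d L α₀ * (L : ℝ)⁻¹ ^ 3
        + 2 * C1ppGen d L / C3Gen d L
          * (1 + 2 * d * thetaGen d L α₀ * (L : ℝ)⁻¹ ^ 2 + 2 * d * C3Gen d L * ((L : ℝ) ^ k * b)) * (L : ℝ)⁻¹ ^ 2 ≤ 1 := by
  have hL1 : 1 ≤ L := le_trans (by norm_num) hL
  have hquot : 2 * C1ppGen d L / C3Gen d L = 1 / 8 := by
    have := C1ppGen_pos d hL1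
    rw [C3Gen]; field_simp; ring
  rw [hquot]; exact id

include hL hG hU₀ hα hα3 hα4 h52 hb hB hsmall hc₃ h145 h155 in
/-- **PROPOSITION 5 (157) AT A GENERAL BACKGROUND, PER BOND, k-UNIFORM, UNCONDITIONAL** «|(δ/δA_b)C_k(U₀, A, c)| ≦ C₃|A|»: for
every `j ≤ k`, every unit-lattice bond `b = ⟨y, y + e_μ⟩`, `X ∈ 𝔸` and every bond `c` of the `j`-th lattice, `B′ ↦ C_j(B′)(c)`
(`logCovIter − linCovIter`) is differentiable at `B` in the direction `X·δ_b` ((137), `t ∈ ℂ`) with `‖dC_j(B; Xδ_b)(c)‖ ≤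
C₃·(Lʲ)²·L^{−jd}·b·‖X‖` (at `j = k`, `B = ηA`: `C₃|A|·η^d·‖X‖`), and the derivative VANISHES unless `b ⊂ Bʲ(c₋) ∪ Bʲ(c₊)` — the
one-step binders of `B7Prop5GeneralInduction.prop5_157` discharged by `hadd/hsmul/h139/hloc/h148/hdiff_levels` and (131).
[cite: Balaban1985Averaging, Prop. 5 (157) p.42, (149)–(155) pp.40–41] -/
theorem prop5_general_157 (y : Site d) (μ : Fin d) (X : 𝔸) {j : ℕ} (hj : j ≤ k) (z : Site d) (κ : Fin d) :
    HasLineDerivAt ℂ (fun B' => CCovIter L U₀ B' j z κ) (dCov L U₀ B (bump y μ X) j z κ) B (bump y μ X) ∧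
      ‖dCov L U₀ B (bump y μ X) j z κ‖ ≤ C3Gen d L * ((L : ℝ) ^ j) ^ 2 * (((L : ℝ) ^ j) ^ d)⁻¹ * b * ‖X‖ ∧
      (¬ BondIn (loK L j z) (bondHiK L j z κ) y μ → dCov L U₀ B (bump y μ X) j z κ = 0) := by
  have hL1 : 1 ≤ L := le_trans (by norm_num) hL
  obtain ⟨h131, hρ⟩ := h131_levels L hL hG k U₀ hU₀ hα hα3 hα4 h52 B hb hB hsmall hc₃
  exact prop5_157 L hL U₀ k (thetaGen_nonneg d L hα.le) (C1ppGen_pos d hL1).le (C3Gen_pos d hL1) hb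
    (hadd_levels L hL hG k U₀ hU₀ hα hα3 hα4 h52) (hsmul_levels L hL hG k U₀ hU₀ hα hα3 hα4 h52)
    (h139_levels L hL hG k U₀ hU₀ hα hα3 hα4 h52) h145 (hloc_levels L hL k U₀)
    (h148_levels L hL hG k U₀ hU₀ hα hα3 hα4 h52) (hdiff_levels L hL hG k U₀ hU₀ hα hα3 hα4 h52) B h131 hρ
    (h155_of L hL k h155) y μ X hj z κ

include hL hG hU₀ hα hα3 hα4 h52 hb hB hsmall hc₃ h145 h155 in
/-- **PROPOSITION 5 (156) AT A GENERAL BACKGROUND, PER BOND, k-UNIFORM, UNCONDITIONAL** «|(δ/δA_b)Q_k(U₀, ηA, c)| ≦ 1 + 2C′₁α₀ +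
C₃|A|»: the composite `B′ ↦ Q_j(U₀, ηB′)(c)` (`logCovIter`, (127)) is differentiable at `B` in the direction `X·δ_b` with
derivative `dC_j(B; Xδ_b)(c) + LʲηQ_j(U₀)(Xδ_b)(c)` of norm `≤ ((1 + θ(Lʲ/Lᵏ)²)·Lʲ + C₃·(Lʲ)²·b)·L^{−jd}·‖X‖` — (147) + (157)
via (134). [cite: Balaban1985Averaging, Prop. 5 (156) p.42, (134) p.38] -/
theorem prop5_general_156 (y : Site d) (μ : Fin d) (X : 𝔸) {j : ℕ} (hj : j ≤ k) (z : Site d) (κ : Fin d) :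
    HasLineDerivAt ℂ (fun B' => logCovIter L U₀ B' j z κ)
        (dCov L U₀ B (bump y μ X) j z κ + linCovIter L U₀ (bump y μ X) j z κ) B (bump y μ X) ∧
      ‖dCov L U₀ B (bump y μ X) j z κ + linCovIter L U₀ (bump y μ X) j z κ‖ ≤
        ((1 + thetaGen d L α₀ * ((L : ℝ) ^ j * ((L : ℝ) ^ k)⁻¹) ^ 2) * (L : ℝ) ^ j + C3Gen d L * ((L : ℝ) ^ j) ^ 2 * b)
          * (((L : ℝ) ^ j) ^ d)⁻¹ * ‖X‖ := by
  have hL1 : 1 ≤ L := le_trans (by norm_num) hL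
  obtain ⟨h131, hρ⟩ := h131_levels L hL hG k U₀ hU₀ hα hα3 hα4 h52 B hb hB hsmall hc₃
  exact prop5_156 L hL U₀ k (thetaGen_nonneg d L hα.le) (C1ppGen_pos d hL1).le (C3Gen_pos d hL1) hb
    (hadd_levels L hL hG k U₀ hU₀ hα hα3 hα4 h52) (hsmul_levels L hL hG k U₀ hU₀ hα hα3 hα4 h52)
    (h139_levels L hL hG k U₀ hU₀ hα hα3 hα4 h52) h145 (hloc_levels L hL k U₀)
    (h148_levels L hL hG k U₀ hU₀ hα hα3 hα4 h52) (hdiff_levels L hL hG k U₀ hU₀ hα hα3 hα4 h52) B h131 hρ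
    (h155_of L hL k h155) y μ X hj z κ


/-! ## §4 Proposition 5 at `j = k` IN THE PRINTED VARIABLES `A`, `η = L^{−k}` -/

variable (A : Site d → Fin d → 𝔸) {a : ℝ} (ha : 0 ≤ a) (hA : ∀ x κ, ‖A x κ‖ ≤ a)
  (hsmallA : Real.exp (4 * (800 * ((d : ℝ) + 1) ^ 2 * ((d : ℝ) + 4)) * α₀)
    * (1 + 8 * (131072 * ((d : ℝ) + 1) ^ 2) * a) ≤ 2)
  (hc₃A : 4 * a < c3 d L)
  (h155A : (2 * (L : ℝ) - 1) * (L : ℝ)⁻¹ ^ 2 + 2 * d * thetaGen d L α₀ * (L : ℝ)⁻¹ ^ 3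
    + 1 / 8 * (1 + 2 * d * thetaGen d L α₀ * (L : ℝ)⁻¹ ^ 2 + 2 * d * C3Gen d L * a) * (L : ℝ)⁻¹ ^ 2 ≤ 1)

omit [CompleteSpace 𝔸] [NormOneClass 𝔸] in
include hL hA in
/-- the rescaled field `B = ηA` has `|B| ≤ ηa` and `Lᵏ·(ηa) = a`. [folklore] -/
private theorem rescale_bounds :
    (∀ x κ', ‖((((L : ℝ) ^ k)⁻¹) • A) x κ'‖ ≤ ((L : ℝ) ^ k)⁻¹ * a) ∧
      (L : ℝ) ^ k * (((L : ℝ) ^ k)⁻¹ * a) = a := by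
  have hL0 : (0 : ℝ) < L := by exact_mod_cast lt_of_lt_of_le (by norm_num) hL
  have hLk : (L : ℝ) ^ k ≠ 0 := by positivity
  have hη0 : 0 ≤ ((L : ℝ) ^ k)⁻¹ := by positivity
  refine ⟨fun x κ' => ?_, by rw [← mul_assoc, mul_inv_cancel₀ hLk, one_mul]⟩
  rw [Pi.smul_apply, Pi.smul_apply, norm_real_smul _ hη0]
  exact mul_le_mul_of_nonneg_left (hA x κ') hη0

include hL hG hU₀ hα hα3 hα4 h52 ha hA hsmallA hc₃A h145 h155A in
/-- **PROPOSITION 5 (157) AT A GENERAL BACKGROUND IN THE PRINTED VARIABLES.**  p. 42: «|(δ/δA_b)C_k(U₀, A, c)| ≦ C₃|A| <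
C₃α₁ (157)».  `A` a field on the `η = L^{−k}`-lattice (sites labelled by `ℤᵈ`) with `|A| = sup_b|A_b| ≤ a`, `C_k(U₀, A)(c) =
Q_k(U₀, ηA)(c) − (Q_k(U₀)A)(c)` (134) (`= CCovIter L U₀ (ηA) k`, `Lᵏη = 1`), derivative in the single-bond direction `X·δ_b`,
`b = ⟨y, y + e_μ⟩` ((137), `t ∈ ℂ`): it exists, `|dC_k(U₀, A; Xδ_b)(c)| ≤ C₃|A|·η^d|X|` — i.e. `|(δ/δA_b)C_k(U₀, A, c)| ≦
C₃|A|` in the normalisation (138) — and it VANISHES unless `b ⊂ Bᵏ(c₋) ∪ Bᵏ(c₊)`; `U₀` in Prop. 2's regime (52), «α₀, α₁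
sufficiently small» = the displayed `hsmallA`/`hc₃A`/`h145`/`h155A` (`B7Prop5Flat.prop5_flat_157` is the case `U₀ = 1`).
[cite: Balaban1985Averaging, Prop. 5 (157) p.42, (134) p.38, (137)–(138) p.39] -/
theorem prop5_general_157_printed (y : Site d) (μ : Fin d) (X : 𝔸) (z : Site d) (κ : Fin d) :
    HasLineDerivAt ℂ (fun A' => CCovIter L U₀ ((((L : ℝ) ^ k)⁻¹) • A') k z κ)
        (dCov L U₀ ((((L : ℝ) ^ k)⁻¹) • A) (bump y μ ((((L : ℝ) ^ k)⁻¹) • X)) k z κ) A (bump y μ X) ∧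
      ‖dCov L U₀ ((((L : ℝ) ^ k)⁻¹) • A) (bump y μ ((((L : ℝ) ^ k)⁻¹) • X)) k z κ‖ ≤
        C3Gen d L * a * ((((L : ℝ) ^ k)⁻¹) ^ d * ‖X‖) ∧
      (¬ BondIn (loK L k z) (bondHiK L k z κ) y μ →
        dCov L U₀ ((((L : ℝ) ^ k)⁻¹) • A) (bump y μ ((((L : ℝ) ^ k)⁻¹) • X)) k z κ = 0) := by
  set η : ℝ := ((L : ℝ) ^ k)⁻¹ with hη
  have hη0 : 0 < η := by positivity
  have hLη : (L : ℝ) ^ k * η = 1 := mul_inv_cancel₀ (by positivity)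
  obtain ⟨hB, hLkb⟩ := rescale_bounds L hL k A hA
  have hsmall' : Real.exp (4 * (800 * ((d : ℝ) + 1) ^ 2 * ((d : ℝ) + 4)) * α₀)
      * (1 + 8 * (131072 * ((d : ℝ) + 1) ^ 2) * ((L : ℝ) ^ k * (η * a))) ≤ 2 := by rw [hLkb]; exact hsmallA
  have hc₃' : 4 * ((L : ℝ) ^ k * (η * a)) < c3 d L := by rw [hLkb]; exact hc₃A
  have h155' : (2 * (L : ℝ) - 1) * (L : ℝ)⁻¹ ^ 2 + 2 * d * thetaGen d L α₀ * (L : ℝ)⁻¹ ^ 3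
      + 1 / 8 * (1 + 2 * d * thetaGen d L α₀ * (L : ℝ)⁻¹ ^ 2 + 2 * d * C3Gen d L * ((L : ℝ) ^ k * (η * a)))
        * (L : ℝ)⁻¹ ^ 2 ≤ 1 := by rw [hLkb]; exact h155A
  obtain ⟨h1, h2, h3⟩ := prop5_general_157 L hL hG k U₀ hU₀ hα hα3 hα4 h52 (η • A) (by positivity) hB hsmall' hc₃'
    h145 h155' y μ (η • X) le_rfl z κ
  have e1 : (((L : ℝ) ^ k) ^ d)⁻¹ = η ^ d := by rw [hη, inv_pow]
  refine ⟨?_, h2.trans (le_of_eq ?_), h3⟩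
  · have h1' : HasDerivAt (fun t : ℂ => CCovIter L U₀ (η • A + t • bump y μ (η • X)) k z κ)
        (dCov L U₀ (η • A) (bump y μ (η • X)) k z κ) 0 := h1
    show HasDerivAt (fun t : ℂ => CCovIter L U₀ (η • (A + t • bump y μ X)) k z κ) _ 0
    refine h1'.congr_of_eventuallyEq (Filter.Eventually.of_forall fun t => ?_)
    simp only [smul_line, smul_bump]
  · rw [norm_real_smul η hη0.le, e1, ← hη]
    calc C3Gen d L * ((L : ℝ) ^ k) ^ 2 * η ^ d * (η * a) * (η * ‖X‖)
        = C3Gen d L * a * (η ^ d * ‖X‖) * ((L : ℝ) ^ k * η) ^ 2 := by ring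
      _ = C3Gen d L * a * (η ^ d * ‖X‖) := by rw [hLη]; ring

include hL hG hU₀ hα hα3 hα4 h52 ha hA hsmallA hc₃A h145 h155A in
/-- **PROPOSITION 5 (156) AT A GENERAL BACKGROUND IN THE PRINTED VARIABLES.**  p. 42: «The functional derivative of Q_k(U₀, ηA)
is a bounded function for α₀, α₁ sufficiently small, and we have the bounds |(δ/δA_b)Q_k(U₀, ηA, c)| ≦ 1 + 2C′₁α₀ + C₃|A| < 1 +
2C′₁α₀ + C₃α₁ (156)»: for `|A| ≤ a`, every bond `b = ⟨y, y + e_μ⟩`, `X ∈ 𝔸`, every bond `c ⊂ Ω^{(k)}`, `A ↦ Q_k(U₀, ηA)(c)` (the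
composite (127), `logCovIter L U₀ (ηA) k`) is differentiable in the direction `X·δ_b` and `|dQ_k(U₀, ηA; Xδ_b)(c)| ≤ (1 + θ +
C₃|A|)·η^d|X|` with `θ = thetaGen d L α₀` = print's `2C′₁α₀` — i.e. `|(δ/δA_b)Q_k(U₀, ηA, c)| ≦ 1 + 2C′₁α₀ + C₃|A|` in the
normalisation (138) (`B7Prop5Flat.prop5_flat_156` is the case `U₀ = 1`, `α₀ = 0`). [cite: Balaban1985Averaging, Prop. 5 (156) p.42, (127) p.37, (137)–(138) p.39] -/
theorem prop5_general_156_printed (y : Site d) (μ : Fin d) (X : 𝔸) (z : Site d) (κ : Fin d) :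
    LineDifferentiableAt ℂ (fun A' => logCovIter L U₀ ((((L : ℝ) ^ k)⁻¹) • A') k z κ) A (bump y μ X) ∧
      ‖lineDeriv ℂ (fun A' => logCovIter L U₀ ((((L : ℝ) ^ k)⁻¹) • A') k z κ) A (bump y μ X)‖ ≤
        (1 + thetaGen d L α₀ + C3Gen d L * a) * ((((L : ℝ) ^ k)⁻¹) ^ d * ‖X‖) := by
  set η : ℝ := ((L : ℝ) ^ k)⁻¹ with hη
  have hη0 : 0 < η := by positivity
  have hLη : (L : ℝ) ^ k * η = 1 := mul_inv_cancel₀ (by positivity)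
  obtain ⟨hB, hLkb⟩ := rescale_bounds L hL k A hA
  have hsmall' : Real.exp (4 * (800 * ((d : ℝ) + 1) ^ 2 * ((d : ℝ) + 4)) * α₀)
      * (1 + 8 * (131072 * ((d : ℝ) + 1) ^ 2) * ((L : ℝ) ^ k * (η * a))) ≤ 2 := by rw [hLkb]; exact hsmallA
  have hc₃' : 4 * ((L : ℝ) ^ k * (η * a)) < c3 d L := by rw [hLkb]; exact hc₃A
  have h155' : (2 * (L : ℝ) - 1) * (L : ℝ)⁻¹ ^ 2 + 2 * d * thetaGen d L α₀ * (L : ℝ)⁻¹ ^ 3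
      + 1 / 8 * (1 + 2 * d * thetaGen d L α₀ * (L : ℝ)⁻¹ ^ 2 + 2 * d * C3Gen d L * ((L : ℝ) ^ k * (η * a)))
        * (L : ℝ)⁻¹ ^ 2 ≤ 1 := by rw [hLkb]; exact h155A
  obtain ⟨h1, h2⟩ := prop5_general_156 L hL hG k U₀ hU₀ hα hα3 hα4 h52 (η • A) (by positivity) hB hsmall' hc₃' h145
    h155' y μ (η • X) le_rfl z κ
  have h1' : HasDerivAt (fun t : ℂ => logCovIter L U₀ (η • A + t • bump y μ (η • X)) k z κ)
      (dCov L U₀ (η • A) (bump y μ (η • X)) k z κ + linCovIter L U₀ (bump y μ (η • X)) k z κ) 0 := h1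
  have hA' : HasLineDerivAt ℂ (fun A' => logCovIter L U₀ (η • A') k z κ)
      (dCov L U₀ (η • A) (bump y μ (η • X)) k z κ + linCovIter L U₀ (bump y μ (η • X)) k z κ) A (bump y μ X) := by
    show HasDerivAt (fun t : ℂ => logCovIter L U₀ (η • (A + t • bump y μ X)) k z κ) _ 0
    refine h1'.congr_of_eventuallyEq (Filter.Eventually.of_forall fun t => ?_)
    simp only [smul_line, smul_bump]
  refine ⟨hA'.lineDifferentiableAt, ?_⟩
  rw [hA'.lineDeriv]
  refine h2.trans (le_of_eq ?_)
  have e1 : (((L : ℝ) ^ k) ^ d)⁻¹ = η ^ d := by rw [hη, inv_pow]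
  rw [norm_real_smul η hη0.le, e1, ← hη]
  calc ((1 + thetaGen d L α₀ * ((L : ℝ) ^ k * η) ^ 2) * (L : ℝ) ^ k + C3Gen d L * ((L : ℝ) ^ k) ^ 2 * (η * a))
        * η ^ d * (η * ‖X‖)
      = ((1 + thetaGen d L α₀ * ((L : ℝ) ^ k * η) ^ 2) * ((L : ℝ) ^ k * η)
          + C3Gen d L * a * ((L : ℝ) ^ k * η) ^ 2) * (η ^ d * ‖X‖) := by ring
    _ = (1 + thetaGen d L α₀ + C3Gen d L * a) * (η ^ d * ‖X‖) := by rw [hLη]; ring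

end Regime

/-- generic arithmetic behind `smallness_sufficient`: in `l = L⁻¹ ≤ ½`, `2dθ ≤ L³/16` and `2dC₃t ≤ 1` give the (155)-type and
the (145)-type conditions. [folklore] -/
private theorem smallness_arith {L d θ C₃ t : ℝ} (hL : 2 ≤ L) (hd : 0 ≤ d) (hθ : 0 ≤ θ)
    (h1 : 2 * d * θ ≤ L ^ 3 / 16) (h2 : 2 * d * C₃ * t ≤ 1) :
    (2 * L - 1) * L⁻¹ ^ 2 + 2 * d * θ * L⁻¹ ^ 3 + 1 / 8 * (1 + 2 * d * θ * L⁻¹ ^ 2 + 2 * d * C₃ * t) * L⁻¹ ^ 2 ≤ 1 ∧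
      8 * d * θ * L⁻¹ ^ 4 ≤ 1 := by
  have hL0 : 0 < L := by linarith
  set l := L⁻¹ with hl_def
  have hl0 : 0 ≤ l := inv_nonneg.mpr hL0.le
  have hl : l ≤ 1 / 2 := by rw [hl_def, inv_eq_one_div, div_le_div_iff₀ hL0 (by norm_num)]; linarith
  have hLl : L * l = 1 := mul_inv_cancel₀ hL0.ne'
  have hdθ : 0 ≤ 2 * d * θ := by positivity
  have hA : 2 * d * θ * l ^ 3 ≤ 1 / 16 := by
    calc 2 * d * θ * l ^ 3 ≤ L ^ 3 / 16 * l ^ 3 := mul_le_mul_of_nonneg_right h1 (by positivity)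
      _ = (L * l) ^ 3 / 16 := by ring
      _ = 1 / 16 := by rw [hLl]; norm_num
  have hB : 2 * d * θ * l ^ 4 ≤ l / 16 := by
    calc 2 * d * θ * l ^ 4 ≤ L ^ 3 / 16 * l ^ 4 := mul_le_mul_of_nonneg_right h1 (by positivity)
      _ = (L * l) ^ 3 * l / 16 := by ring
      _ = l / 16 := by rw [hLl]; ring
  refine ⟨?_, ?_⟩
  · have hT1 : (2 * L - 1) * l ^ 2 ≤ 3 / 4 := by
      have e : (2 * L - 1) * l ^ 2 = 2 * (L * l) * l - l ^ 2 := by ring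
      rw [e, hLl]
      nlinarith [mul_nonneg (sub_nonneg.2 hl) (by linarith : (0 : ℝ) ≤ 3 / 2 - l)]
    have hT3 : 1 / 8 * (1 + 2 * d * θ * l ^ 2 + 2 * d * C₃ * t) * l ^ 2 ≤ 1 / 8 * (1 / 2 + 1 / 32) := by
      have e : 1 / 8 * (1 + 2 * d * θ * l ^ 2 + 2 * d * C₃ * t) * l ^ 2
          = 1 / 8 * (l ^ 2 + 2 * d * θ * l ^ 4 + 2 * d * C₃ * t * l ^ 2) := by ring
      rw [e]
      have hl2 : l ^ 2 ≤ 1 / 4 := by nlinarith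
      have h3 : 2 * d * C₃ * t * l ^ 2 ≤ l ^ 2 := by
        have := mul_le_mul_of_nonneg_right h2 (sq_nonneg l); linarith
      have h4 : l / 16 ≤ 1 / 32 := by linarith
      linarith
    linarith [hA, hT1, hT3]
  · calc 8 * d * θ * l ^ 4 = 4 * (2 * d * θ * l ^ 4) := by ring
      _ ≤ 4 * (l / 16) := by linarith [hB]
      _ ≤ 1 := by linarith

/-- **NON-VACUITY OF THE DISPLAYED SMALLNESS** («α₀, α₁ sufficiently small», p. 41; print: «This inequality is satisfied if C₃ >
C″₁ and α₀, α₁ are sufficiently small»): for `L ≥ 2` the two conditions `h145` («16dC′₁L^{−4}α₀ ≦ 1») and `h155` ((155) per bond)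
of `prop5_general_157`/`prop5_general_156` — in EXACTLY the form they are consumed, `t = Lᵏb = |A|` — FOLLOW from the pair
`2d·thetaGen d L α₀ ≤ L³/16` (a bound on `α₀`) and `2d·C3Gen d L·(Lᵏb) ≤ 1` (a bound on the field). [cite: Balaban1985Averaging, (155) p.41, (145) p.40] -/
theorem smallness_sufficient {L : ℕ} (hL : 2 ≤ L) (d k : ℕ) {α₀ b : ℝ} (hα : 0 ≤ α₀)
    (h1 : 2 * d * thetaGen d L α₀ ≤ (L : ℝ) ^ 3 / 16) (h2 : 2 * d * C3Gen d L * ((L : ℝ) ^ k * b) ≤ 1) :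
    8 * d * thetaGen d L α₀ * (L : ℝ)⁻¹ ^ 4 ≤ 1 ∧
      (2 * (L : ℝ) - 1) * (L : ℝ)⁻¹ ^ 2 + 2 * d * thetaGen d L α₀ * (L : ℝ)⁻¹ ^ 3
        + 1 / 8 * (1 + 2 * d * thetaGen d L α₀ * (L : ℝ)⁻¹ ^ 2 + 2 * d * C3Gen d L * ((L : ℝ) ^ k * b))
          * (L : ℝ)⁻¹ ^ 2 ≤ 1 := by
  have hL' : (2 : ℝ) ≤ L := by exact_mod_cast hL
  have h := smallness_arith hL' (Nat.cast_nonneg d) (thetaGen_nonneg d L hα) h1 h2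
  exact ⟨h.2, h.1⟩

end Literature.MathematicalPhysics.QuantumFieldTheory.Balaban1983to89.B7Prop5General

end
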